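import Literature.AlgebraicGeometry.Resolution.AlterationsMultisectionLocalStep
import Literature.AlgebraicGeometry.Resolution.LiuFlatIntegral
import HarnessLib

/-!
# De Jong's alteration theorem: "any component of `H` dominates `Y`" — the generic étaleness input of Lemma 4.13, proved

Topic: `Literature/AlgebraicGeometry/Resolution`. Companion to `AlterationsMultisectionLocalStep.lean`,
which cuts the local step of de Jong 1996, Lemma 4.13 into three named facts. This file PROVES
the third one, `DeJong1996MultisectionGenericallyEtale`:

> "Any component of `H` dominates `Y` in view of dimensions, hence `f|_H` is generically
> étale." (p. 70)

for `f : X → Y` as in Lemma 4.13 and an effective Cartier divisor `H = V(I) ⊂ X` with `f|_H`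
finite and étale over a non-empty open `V ⊆ Y`. Instead of the global dimension count
(`dim H_i = dim X - 1 = dim Y`, which needs catenarity), the dominance is proved locally:

* **Krull.** Every point of `H` is a specialisation of a point `ξ ∈ H` of coheight `≤ 1` in `X`
  (`IsEffectiveCartier.exists_specializes_coheight_le_one`): on an affine chart `H = V(h)`, a
  minimal prime of `(h)` below the given prime has height `≤ 1` by Krull's Hauptidealsatz
  (Mathlib `Ideal.height_le_one_of_isPrincipal_of_mem_minimalPrimes`), and heights are
  coheights of points (Mathlib `idealHeight_eq_coheight`, Stacks 02IZ).
* **The fibre.** Let `ξ ∈ H` have coheight `≤ 1` and put `y₁ = f(ξ)`. The closure of `ξ` in the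
  fibre `X_{y₁}` lies in the finite set `H ∩ f⁻¹(y₁)`; the fibre is a Jacobson space (finite type
  over `κ(y₁)`) all of whose irreducible components have dimension `1`, so `ξ` is not a maximal
  point of `X_{y₁}` (`not_isMax_of_finite_closure`: otherwise its closure would be a finite, hence
  discrete, irreducible component of dimension `1`). A proper generisation `x₁` of `ξ` inside
  `f⁻¹(y₁)` has coheight `0` in `X`, i.e. is the generic point of `X`, which maps to the generic
  point of `Y`; so `y₁ = η_Y` (`apply_eq_genericPoint_of_coheight_le_one`).
* **Hence generically étale.** `H ∩ f⁻¹(V)` contains every such `ξ`, so is dense in `H`; over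
  `V` the divisor `H` is étale over the integral `V`, hence reduced
  (`isReduced_of_etale_of_isIntegral`: flat with reduced generic fibre, Liu 4.3.8 =
  `isReduced_of_flat_of_isReduced_fiber_genericPoint`, the generic fibre being étale over a field),
  so the reduced closed subscheme `H_red ↪ H` (2.2) is an isomorphism over `f⁻¹(V)` and
  `H_red → Y` is étale on the dense open `H_red ∩ f⁻¹(V)`; it is finite as `H_red ↪ H → Y`.
  This is `isFiniteGenericallyEtaleOn_of_etale_morphismRestrict`, whence
  **`DeJong1996MultisectionGenericallyEtale_holds`** and the local step of Lemma 4.13 from the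
  two remaining named inputs (`DeJong1996MultisectionLocal.of_hyperplane_of_etaleNhd`).

## Sources

* A. J. de Jong, *Smoothness, semi-stability and alterations*, Publ. Math. IHÉS 83 (1996) 51–93:
  Lemma 4.13 (proof), p. 70. [DeJong1996]
* The Stacks Project, Tag 02IZ (dimension of local rings and codimension), Tag 00KV (Krull's
  Hauptidealsatz). [StacksProject]
* Q. Liu, *Algebraic Geometry and Arithmetic Curves* (2002), Prop. 4.3.8. [Liu2002]
-/

noncomputable section

open CategoryTheory CategoryTheory.Limits AlgebraicGeometry TopologicalSpace Topology

namespace Literature.AlgebraicGeometry.Resolution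

universe u

/-! ## Generic points -/

/-- A surjective morphism of irreducible schemes maps the generic point to the generic point.
[folklore] -/
theorem apply_genericPoint_eq_of_surjective {X Y : Scheme.{u}} [IrreducibleSpace X]
    [IrreducibleSpace Y] (f : X ⟶ Y) [Surjective f] :
    f (genericPoint X) = genericPoint Y := by
  obtain ⟨x, hx⟩ := f.surjective (genericPoint Y)
  have h1 : f (genericPoint X) ⤳ genericPoint Y := by
    rw [← hx]
    exact (genericPoint_specializes x).map f.continuous
  exact (h1.antisymm (genericPoint_specializes _)).eq

/-- The generic point of an irreducible scheme lies in every non-empty open. [folklore] -/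
theorem genericPoint_mem_of_nonempty {Y : Scheme.{u}} [IrreducibleSpace Y] (V : Y.Opens)
    (hV : (V : Set Y).Nonempty) : genericPoint Y ∈ V := by
  obtain ⟨v, hv⟩ := hV
  exact ((genericPoint_spec Y).mem_open_set_iff V.isOpen).mpr ⟨v, trivial, hv⟩

/-! ## Krull: points of a Cartier divisor specialise from points of coheight `≤ 1` -/

/-- On an affine open `U`, the point of `X` defined by a prime `𝔯` of `Γ(X, U)` lies in the
basic open `X_s`, `s ∈ Γ(X, U)`, iff `s ∉ 𝔯`. [folklore] -/
theorem fromSpec_mem_basicOpen_iff {X : Scheme.{u}} {U : X.Opens}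
    (hU : IsAffineOpen U) (s : Γ(X, U)) (𝔯 : Spec Γ(X, U)) :
    hU.fromSpec 𝔯 ∈ X.basicOpen s ↔ s ∉ 𝔯.asIdeal := by
  rw [← PrimeSpectrum.mem_basicOpen]
  change 𝔯 ∈ hU.fromSpec ⁻¹ᵁ X.basicOpen s ↔ _
  rw [hU.fromSpec_preimage_basicOpen]
  rfl

/-- On an affine chart `U` where the ideal sheaf `I` is generated by `h ∈ Γ(X, U)`, the point of
`X` defined by a prime `𝔯` of `Γ(X, U)` lies in the support `V(I)` iff `h ∈ 𝔯`. [folklore] -/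
theorem fromSpec_mem_support_iff_of_ideal_eq_span {X : Scheme.{u}} {I : X.IdealSheafData}
    {U : X.affineOpens} {h : Γ(X, U)} (hIU : I.ideal U = Ideal.span {h})
    (𝔯 : Spec Γ(X, U)) : U.2.fromSpec 𝔯 ∈ I.support ↔ h ∈ 𝔯.asIdeal := by
  have hmem : U.2.fromSpec 𝔯 ∈ (U : X.Opens) := U.2.range_fromSpec.le ⟨𝔯, rfl⟩
  rw [Scheme.IdealSheafData.mem_support_iff_of_mem (U := U) hmem, hIU, Scheme.mem_zeroLocus_iff]
  constructor
  · intro H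
    have := H h (Ideal.subset_span rfl)
    rwa [fromSpec_mem_basicOpen_iff U.2, not_not] at this
  · intro H s hs hsb
    obtain ⟨a, rfl⟩ := Ideal.mem_span_singleton'.mp hs
    rw [fromSpec_mem_basicOpen_iff U.2] at hsb
    exact hsb (𝔯.asIdeal.mul_mem_left a H)

/-- **Krull's Hauptidealsatz for an effective Cartier divisor.** On an integral locally
Noetherian scheme `X`, every point `x` of the support `H = V(I)` of an effective Cartier divisor
`I` is a specialisation of a point `ξ ∈ H` of coheight `≤ 1` in `X` (a generic point of a
component of `H` through `x`): on an affine chart `H ∩ U = V(h)`, a minimal prime of `(h)` below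
the prime of `x` has height `≤ 1` (Mathlib `Ideal.height_le_one_of_isPrincipal_of_mem_minimalPrimes`),
and the height of a prime is the coheight of the corresponding point (Stacks 02IZ, Mathlib
`idealHeight_eq_coheight`, `coheight_eq_of_isOpenImmersion`).
[cite: StacksProject, Tag 00KV and Tag 02IZ] -/
theorem IsEffectiveCartier.exists_specializes_coheight_le_one {X : Scheme.{u}}
    [IsLocallyNoetherian X] {I : X.IdealSheafData} (hI : IsEffectiveCartier I) {x : X}
    (hx : x ∈ I.support) :
    ∃ ξ : X, ξ ∈ I.support ∧ ξ ⤳ x ∧ Order.coheight ξ ≤ 1 := by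
  obtain ⟨U, hxU, h, -, hIU⟩ := hI x
  haveI : IsNoetherianRing Γ(X, U) := IsLocallyNoetherian.component_noetherian U
  -- the prime of `x` contains `h`
  set 𝔮 := U.2.primeIdealOf ⟨x, hxU⟩ with h𝔮
  have hx𝔮 : U.2.fromSpec 𝔮 = x := U.2.fromSpec_primeIdealOf ⟨x, hxU⟩
  have hh𝔮 : h ∈ 𝔮.asIdeal := by
    rw [← fromSpec_mem_support_iff_of_ideal_eq_span hIU, hx𝔮]
    exact hx
  -- a minimal prime of `(h)` below it
  obtain ⟨𝔭, h𝔭, h𝔭𝔮⟩ := Ideal.exists_minimalPrimes_le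
    (show Ideal.span {h} ≤ 𝔮.asIdeal from (Ideal.span_singleton_le_iff_mem _).mpr hh𝔮)
  haveI h𝔭p : 𝔭.IsPrime := h𝔭.1.1
  refine ⟨U.2.fromSpec ⟨𝔭, h𝔭p⟩, ?_, ?_, ?_⟩
  · rw [fromSpec_mem_support_iff_of_ideal_eq_span hIU]
    exact h𝔭.1.2 (Ideal.subset_span rfl)
  · rw [← hx𝔮]
    exact ((PrimeSpectrum.le_iff_specializes _ _).mp
      (show (⟨𝔭, h𝔭p⟩ : Spec Γ(X, U)) ≤ 𝔮 from h𝔭𝔮)).map U.2.fromSpec.continuous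
  · rw [show U.2.fromSpec ⟨𝔭, h𝔭p⟩ = U.2.fromSpec.base ⟨𝔭, h𝔭p⟩ from rfl,
      coheight_eq_of_isOpenImmersion, ← idealHeight_eq_coheight]
    exact Ideal.height_le_one_of_isPrincipal_of_mem_minimalPrimes (Ideal.span {h}) 𝔭 h𝔭

/-! ## Fibres: points with finite closure are not maximal -/

/-- In a Jacobson scheme (e.g. a scheme locally of finite type over a field) all of whose
irreducible components have dimension `1`, a point with finite closure is not maximal for the
specialisation order: otherwise its closure would be an irreducible component, finite, hence a
discrete (Jacobson) space of dimension `0 ≠ 1`. [folklore] -/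
theorem not_isMax_of_finite_closure {F : Scheme.{u}} [JacobsonSpace F]
    (hdim : ∀ C ∈ irreducibleComponents F, topologicalKrullDim ↥C = 1) {z : F}
    (hfin : (closure ({z} : Set F)).Finite) : ¬ IsMax z := by
  intro hM
  -- the closure of a maximal point is an irreducible component
  have hC : closure ({z} : Set F) ∈ irreducibleComponents F := by
    refine ⟨isIrreducible_singleton.closure, fun t ht hzt => ?_⟩
    have hγ : IsGenericPoint ht.genericPoint (closure t) := ht.isGenericPoint_genericPoint_closure
    have hzt' : z ∈ closure t := subset_closure (hzt (subset_closure rfl))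
    have hγz : ht.genericPoint ⤳ z := hγ.specializes hzt'
    have hzγ : z ⤳ ht.genericPoint := hM hγz
    calc t ⊆ closure t := subset_closure
      _ = closure {ht.genericPoint} := hγ.symm
      _ ⊆ closure {z} := closure_minimal
          (Set.singleton_subset_iff.mpr (specializes_iff_mem_closure.mp hzγ)) isClosed_closure
  have h1 := hdim _ hC
  haveI : Finite (closure ({z} : Set F)) := hfin.to_subtype
  haveI : JacobsonSpace (closure ({z} : Set F)) :=
    .of_isClosedEmbedding isClosed_closure.isClosedEmbedding_subtypeVal
  have h0 : topologicalKrullDim (closure ({z} : Set F)) ≤ 0 :=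
    topologicalKrullDim_zero_of_discreteTopology _
  rw [h1] at h0
  exact absurd h0 (by decide)

/-! ## Dominance: "any component of `H` dominates `Y`" -/

/-- **de Jong 1996, proof of 4.13: "Any component of `H` dominates `Y` in view of dimensions"**,
in the local form: let `f : X → Y` be a surjective morphism, locally of finite type, of integral
schemes all of whose fibres have all irreducible components of dimension `1`, and let `H ⊆ X` be
closed with `H ∩ f⁻¹(y)` finite for every `y`. Then every point `ξ ∈ H` of coheight `≤ 1` in `X`
(e.g. a generic point of a component of a Cartier divisor) maps to the generic point of `Y`.
Indeed `ξ` is not maximal in its fibre `X_{f(ξ)}` (`not_isMax_of_finite_closure`), and a proper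
generisation of `ξ` has coheight `0`, i.e. is the generic point of `X`, which maps to the generic
point of `Y`. [cite: DeJong1996, Lemma 4.13 (proof), p. 70] -/
theorem apply_eq_genericPoint_of_coheight_le_one {X Y : Scheme.{u}} [IsIntegral X]
    [IsIntegral Y] (f : X ⟶ Y) [Surjective f] [LocallyOfFiniteType f]
    (hdim : ∀ (y : Y), ∀ C ∈ irreducibleComponents ↥(f.fiber y), topologicalKrullDim ↥C = 1)
    {H : Set X} (hH : IsClosed H) (hfin : ∀ y : Y, (H ∩ f ⁻¹' {y}).Finite)
    {ξ : X} (hξ : ξ ∈ H) (hco : Order.coheight ξ ≤ 1) : f ξ = genericPoint Y := by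
  set y₁ := f ξ with hy₁
  -- the point of the fibre over `ξ`; its closure in the fibre is finite
  have hξ' : f.fiberι y₁ (f.asFiber ξ) = ξ := f.fiberι_asFiber ξ
  have hmemy : ∀ z : ↥(f.fiber y₁), f.fiberι y₁ z ∈ f ⁻¹' {y₁} := fun z => by
    rw [← Scheme.Hom.range_fiberι]
    exact ⟨z, rfl⟩
  have hS : (closure ({f.asFiber ξ} : Set ↥(f.fiber y₁))).Finite := by
    have hcl : closure ({f.asFiber ξ} : Set ↥(f.fiber y₁)) ⊆ (f.fiberι y₁) ⁻¹' H :=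
      closure_minimal (Set.singleton_subset_iff.mpr (show f.fiberι y₁ (f.asFiber ξ) ∈ H by
        rw [hξ']; exact hξ)) (hH.preimage (f.fiberι y₁).continuous)
    refine ((hfin y₁).preimage (f.fiberι y₁).isEmbedding.injective.injOn).subset ?_
    intro z hz
    exact ⟨hcl hz, hmemy z⟩
  -- so it is not maximal in the fibre: a proper generisation `γ`
  obtain ⟨γ, hγ⟩ := not_isMax_iff.mp (not_isMax_of_finite_closure (hdim y₁) hS)
  set x₁ := f.fiberι y₁ γ with hx₁
  have h1 : x₁ ⤳ ξ := by
    rw [← hξ']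
    exact (show γ ⤳ f.asFiber ξ from hγ.le).map (f.fiberι y₁).continuous
  have h2 : x₁ ≠ ξ := fun h =>
    hγ.ne' ((f.fiberι y₁).isEmbedding.injective (h.trans hξ'.symm))
  have hfx₁ : f x₁ = y₁ := hmemy γ
  -- `ξ < x₁` in `X`, so `x₁` has coheight `0`: it is the generic point of `X`
  have hlt : ξ < x₁ := lt_of_le_not_ge (show ξ ≤ x₁ from h1) fun h => h2 (h1.antisymm h).eq
  have hco1 : Order.coheight x₁ + 1 ≤ 1 := (Order.coheight_add_one_le hlt).trans hco
  have hmax : IsMax x₁ := by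
    by_contra hnm
    have hpos : (1 : ℕ∞) ≤ Order.coheight x₁ :=
      Order.one_le_iff_ne_zero.mpr (Order.coheight_ne_zero.mpr hnm)
    have h21 : (1 : ℕ∞) + 1 ≤ 1 := (add_le_add hpos le_rfl).trans hco1
    exact absurd h21 (by decide)
  have htop : x₁ = genericPoint X :=
    (Specializes.antisymm (hmax le_top) (genericPoint_specializes x₁)).eq
  rw [← hfx₁, htop]
  exact apply_genericPoint_eq_of_surjective f

/-! ## Étale over an integral base is reduced -/

/-- A scheme étale over an integral scheme is reduced: it is flat with reduced generic fibre
(the generic fibre is étale over the field `κ(η)`, hence reduced, Stacks 056T), so Liu 2002,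
Prop. 4.3.8 (`isReduced_of_flat_of_isReduced_fiber_genericPoint`) applies.
[cite: Liu2002, Prop. 4.3.8] -/
theorem isReduced_of_etale_of_isIntegral {H V : Scheme.{u}} (g : H ⟶ V) [Etale g]
    [IsIntegral V] : IsReduced H := by
  haveI : IsReduced (g.fiber (genericPoint V)) := by
    haveI : Etale (g.fiberToSpecResidueField (genericPoint V)) :=
      MorphismProperty.pullback_snd _ _ inferInstance
    have hsm : Smooth (g.fiberToSpecResidueField (genericPoint V)) := inferInstance
    exact @Literature.AlgebraicGeometry.Motives.isReduced_of_smooth_over_field _ _ _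
      (g.fiberToSpecResidueField (genericPoint V)) hsm
  exact isReduced_of_flat_of_isReduced_fiber_genericPoint g

/-! ## (i) of Lemma 4.13 for a finite divisor étale over a non-empty open -/

/-- **"Any component of `H` dominates `Y` in view of dimensions, hence `f|_H` is generically
étale"** (de Jong 1996, proof of Lemma 4.13), proved: let `f : X → Y` be a surjective morphism
of integral schemes, locally of finite type, with `X` locally Noetherian and all irreducible
components of all fibres of dimension `1`; let `H = V(I)` be an effective Cartier divisor with
`f|_H` finite and étale over a non-empty open `V ⊆ Y`. Then `f|_H`, for the reduced closed
subscheme structure on `H` (2.2), is finite and generically étale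
(`DeJong1996.IsFiniteGenericallyEtaleOn f H`): `H ∩ f⁻¹(V)` contains the coheight-`≤ 1` points
of `H` (`apply_eq_genericPoint_of_coheight_le_one`), which generise every point of `H`
(`IsEffectiveCartier.exists_specializes_coheight_le_one`), so it is dense; over `V` the divisor
is reduced (`isReduced_of_etale_of_isIntegral`), so `H_red ↪ H` is an isomorphism there and
`H_red → Y` is étale on `H_red ∩ f⁻¹(V)`. [cite: DeJong1996, Lemma 4.13 (proof), p. 70] -/
theorem isFiniteGenericallyEtaleOn_of_etale_morphismRestrict {X Y : Scheme.{u}} [IsIntegral X]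
    [IsIntegral Y] [IsLocallyNoetherian X] (f : X ⟶ Y) [Surjective f] [LocallyOfFiniteType f]
    (hdim : ∀ (y : Y), ∀ C ∈ irreducibleComponents ↥(f.fiber y), topologicalKrullDim ↥C = 1)
    {I : X.IdealSheafData} (hI : IsEffectiveCartier I) [IsFinite (I.subschemeι ≫ f)]
    (V : Y.Opens) (hV : (V : Set Y).Nonempty) [Etale ((I.subschemeι ≫ f) ∣_ V)] :
    DeJong1996.IsFiniteGenericallyEtaleOn f I.support := by
  open Scheme.IdealSheafData in
  -- `closure H = H`
  have e : (⟨closure (I.support : Set X), isClosed_closure⟩ : Closeds X) = I.support := by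
    ext1
    exact I.support.isClosed.closure_eq
  unfold DeJong1996.IsFiniteGenericallyEtaleOn
  rw [e]
  -- the closed immersion `H_red ↪ H = V(I)`
  have hle : I ≤ vanishingIdeal I.support := by
    rw [vanishingIdeal_support]
    exact I.le_radical
  have hfac : (vanishingIdeal I.support).subschemeι = inclusion hle ≫ I.subschemeι :=
    (inclusion_subschemeι hle).symm
  haveI : IsClosedImmersion (inclusion hle) := by
    have : IsClosedImmersion (inclusion hle ≫ I.subschemeι) := by
      rw [← hfac]
      infer_instance
    exact IsClosedImmersion.of_comp_isClosedImmersion (inclusion hle) I.subschemeι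
  have hcomp : (vanishingIdeal I.support).subschemeι ≫ f = inclusion hle ≫ (I.subschemeι ≫ f) := by
    rw [hfac, Category.assoc]
  -- fibres of `H → Y` are finite
  have hfin : ∀ y : Y, ((I.support : Set X) ∩ f ⁻¹' {y}).Finite := fun y => by
    refine (((I.subschemeι ≫ f).finite_preimage_singleton y).image I.subschemeι).subset ?_
    rintro x ⟨hxH, hxy⟩
    obtain ⟨z, rfl⟩ : x ∈ Set.range I.subschemeι := by
      rw [range_subschemeι]
      exact hxH
    exact ⟨z, show (I.subschemeι ≫ f) z ∈ ({y} : Set Y) by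
      rw [Scheme.Hom.comp_apply]; exact hxy, rfl⟩
  refine ⟨by rw [hcomp]; infer_instance, ?_⟩
  -- the open `W = H ∩ f⁻¹(V)` of the divisor, reduced since étale over the integral `V`
  set W : I.subscheme.Opens := (I.subschemeι ≫ f) ⁻¹ᵁ V with hW
  haveI : IsIntegral (V : Scheme.{u}) := by
    obtain ⟨v, hv⟩ := hV
    haveI : Nonempty (V : Scheme.{u}) := ⟨(⟨v, hv⟩ : V)⟩
    exact isIntegral_of_isOpenImmersion V.ι
  haveI : IsReduced (W : Scheme.{u}) := isReduced_of_etale_of_isIntegral ((I.subschemeι ≫ f) ∣_ V)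
  -- `H_red ↪ H` is an isomorphism over `W`
  haveI : IsIso (inclusion hle ∣_ W) := by
    haveI : Surjective (inclusion hle ∣_ W) := by
      refine ⟨fun w => ?_⟩
      have hw : I.subschemeι w.1 ∈ Set.range (vanishingIdeal I.support).subschemeι := by
        rw [range_subschemeι_vanishingIdeal]
        show I.subschemeι w.1 ∈ (I.support : Set X)
        rw [← range_subschemeι]
        exact ⟨w.1, rfl⟩
      obtain ⟨z, hz⟩ := hw
      have hz' : inclusion hle z = w.1 := by
        apply I.subschemeι.isClosedEmbedding.injective
        rw [← Scheme.Hom.comp_apply, inclusion_subschemeι]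
        exact hz
      refine ⟨⟨z, show inclusion hle z ∈ W by rw [hz']; exact w.2⟩, Subtype.ext ?_⟩
      rw [morphismRestrict_base]
      exact hz'
    exact isIso_of_isClosedImmersion_of_surjective _
  refine ⟨inclusion hle ⁻¹ᵁ W, ?_, ?_⟩
  · -- density: `W` contains the coheight-`≤ 1` points of `H`, which generise every point of `H`
    rw [dense_iff_inter_open]
    rintro G hG ⟨z₀, hz₀⟩
    obtain ⟨G', hG', rfl⟩ :=
      (vanishingIdeal I.support).subschemeι.isClosedEmbedding.isInducing.isOpen_iff.mp hG
    have hx : (vanishingIdeal I.support).subschemeι z₀ ∈ I.support := by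
      show _ ∈ (I.support : Set X)
      rw [← range_subschemeι_vanishingIdeal I.support]
      exact ⟨z₀, rfl⟩
    obtain ⟨ξ, hξH, hξx, hξco⟩ := hI.exists_specializes_coheight_le_one hx
    have hξG' : ξ ∈ G' := hξx.mem_open hG' hz₀
    have hfξ : f ξ = genericPoint Y :=
      apply_eq_genericPoint_of_coheight_le_one f hdim I.support.isClosed hfin hξH hξco
    have hξV : f ξ ∈ V := by
      rw [hfξ]
      exact genericPoint_mem_of_nonempty V hV
    obtain ⟨z, hz⟩ : ξ ∈ Set.range (vanishingIdeal I.support).subschemeι := by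
      rw [range_subschemeι_vanishingIdeal]
      exact hξH
    refine ⟨z, ?_, ?_⟩
    · show (vanishingIdeal I.support).subschemeι z ∈ G'
      rw [hz]
      exact hξG'
    · show (I.subschemeι ≫ f) (inclusion hle z) ∈ V
      rw [← Scheme.Hom.comp_apply, ← hcomp, Scheme.Hom.comp_apply, hz]
      exact hξV
  · -- étaleness on `H_red ∩ f⁻¹(V) ≅ W → V ⊆ Y`
    have heq : (inclusion hle ⁻¹ᵁ W).ι ≫ (vanishingIdeal I.support).subschemeι ≫ f =
        (inclusion hle ∣_ W) ≫ ((I.subschemeι ≫ f) ∣_ V) ≫ V.ι := by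
      rw [morphismRestrict_ι, ← Category.assoc (inclusion hle ∣_ W), morphismRestrict_ι,
        Category.assoc, hcomp]
    rw [heq]
    infer_instance

/-- **de Jong 1996, proof of Lemma 4.13: "Any component of `H` dominates `Y` in view of
dimensions, hence `f|_H` is generically étale" — the named fact
`DeJong1996MultisectionGenericallyEtale`, PROVED** (`isFiniteGenericallyEtaleOn_of_etale_morphismRestrict`;
`X` is locally Noetherian, being projective over `k`). [cite: DeJong1996, Lemma 4.13 (proof), p. 70] -/
theorem DeJong1996MultisectionGenericallyEtale_holds : DeJong1996MultisectionGenericallyEtale.{u} := by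
  intro k _ _ X Y _ _ f _ g hX _ hsurj _ hdim _ I hI hfin V hV hVet
  haveI : IsProper (f ≫ g) :=
    Literature.AlgebraicGeometry.Motives.IsProjectiveOver.isProper (X := Over.mk (f ≫ g)) hX
  haveI : IsLocallyNoetherian X := LocallyOfFiniteType.isLocallyNoetherian (f ≫ g)
  haveI := hsurj
  haveI := hfin
  haveI := hVet
  exact isFiniteGenericallyEtaleOn_of_etale_morphismRestrict f hdim hI V hV

/-- The local step of Lemma 4.13 (`DeJong1996MultisectionLocal`) from the two remaining named
inputs: the hyperplane section (`DeJong1996MultisectionHyperplane`) and the étale neighbourhood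
(`DeJong1996MultisectionEtaleNhd`). [cite: DeJong1996, Lemma 4.13 (proof), pp. 69–70] -/
theorem DeJong1996MultisectionLocal.of_hyperplane_of_etaleNhd
    (hA : DeJong1996MultisectionHyperplane.{u}) (hB : DeJong1996MultisectionEtaleNhd.{u}) :
    DeJong1996MultisectionLocal.{u} :=
  DeJong1996MultisectionLocal.of_hyperplane_of_etaleNhd_of_genericallyEtale hA hB
    DeJong1996MultisectionGenericallyEtale_holds

/-- Lemma 4.13 (`DeJong1996MultisectionLemma`) from the hyperplane section and the étale
neighbourhood. [cite: DeJong1996, Lemma 4.13, pp. 69–70] -/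
theorem DeJong1996MultisectionLemma.of_hyperplane_of_etaleNhd
    (hA : DeJong1996MultisectionHyperplane.{u}) (hB : DeJong1996MultisectionEtaleNhd.{u}) :
    DeJong1996MultisectionLemma.{u} :=
  DeJong1996MultisectionLemma.of_local (DeJong1996MultisectionLocal.of_hyperplane_of_etaleNhd hA hB)

/-- Thm. 4.1 with its generically-étale clause over algebraically closed fields
(`DeJong1996StrongAlgClosed`) from 4.11–4.12, the hyperplane section and the étale neighbourhood
of Lemma 4.13, 4.15–4.22 and 4.23–4.28. [cite: DeJong1996, 4.3–4.28, pp. 66–76] -/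
theorem DeJong1996StrongAlgClosed.of_fibration_hyperplane_etaleNhd_toSemiStablePair_resolution
    (h₁ : DeJong1996FibrationReduction.{u}) (hA : DeJong1996MultisectionHyperplane.{u})
    (hB : DeJong1996MultisectionEtaleNhd.{u}) (h15 : DeJong1996MultisectionToSemiStablePair.{u})
    (hres : DeJong1996SemiStablePairResolution.{u}) : DeJong1996StrongAlgClosed.{u} :=
  DeJong1996StrongAlgClosed.of_fibration_multisectionLocal_toSemiStablePair_resolution h₁
    (DeJong1996MultisectionLocal.of_hyperplane_of_etaleNhd hA hB) h15 hres

/-- Thm. 4.1 (i)+(ii) over every field from 4.5 (`DeJong1996Descent`), 4.11–4.12, the hyperplane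
section and the étale neighbourhood of Lemma 4.13, 4.15–4.22 and 4.23–4.28.
[cite: DeJong1996, 4.3–4.28, pp. 66–76] -/
theorem DeJong1996Strong.of_descent_fibration_hyperplane_etaleNhd_toSemiStablePair_resolution
    (h45 : DeJong1996Descent.{u}) (h₁ : DeJong1996FibrationReduction.{u})
    (hA : DeJong1996MultisectionHyperplane.{u}) (hB : DeJong1996MultisectionEtaleNhd.{u})
    (h15 : DeJong1996MultisectionToSemiStablePair.{u}) (hres : DeJong1996SemiStablePairResolution.{u}) :
    DeJong1996Strong.{u} :=
  DeJong1996Strong.of_descent_fibration_multisectionLocal_toSemiStablePair_resolution h45 h₁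
    (DeJong1996MultisectionLocal.of_hyperplane_of_etaleNhd hA hB) h15 hres

end Literature.AlgebraicGeometry.Resolution

end
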